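import Mathlib
import HarnessLib
import Literature.Analysis.FluidPDE.VorticityFormulationHolds
import Literature.Analysis.FluidPDE.ClassicalSolutionCalculus
import Literature.Analysis.FluidPDE.EnergyToolkit
import Literature.Analysis.FluidPDE.PressurePoisson
import Literature.Analysis.FluidPDE.EnstrophySplitting
import Literature.Analysis.FluidPDE.DeviatoricHessian
import Literature.Analysis.FluidPDE.HeatDuhamelBack
import Literature.Analysis.FluidPDE.SpaceTimeMixedPartials
import Summits.NavierStokesRegularity.NavierStokesRegularity.Theorems.AdaptedFrequencyEnstrophyDensity

/-!
# Crux `IsobarTomography.BlobRiccatiClosure` (stmt-NavierStokesRegularity-11740), line `Sketch`,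
# stub S5 `stub_stretchingEvolution` — the stretching Riccati law in conservative form

Registered stub S5 of the peak-reduction skeleton (a TOOL for the bet S6, not used by the
composition): for a classical solution `(u, p)` of the unforced Navier–Stokes system on
`ℝ³ × [0, T)`, with `ω = curl u`, `A = ∇u` (the Jacobian `Du(x)`, so that `(ω·∇)u = A ω`), the
vortex-stretching density `r = ⟪ω, A ω⟫ = ‖ω‖² α` satisfies, pointwise on `[0, T) × ℝ³`, the exact
identity

  `(∂ₜ + u·∇ − νΔ) r = ‖A ω‖² − D²p[ω, ω] − 2ν Σᵢ (⟪ω, ∂ᵢA ∂ᵢω⟫ + ⟪∂ᵢω, ∂ᵢA ω⟫ + ⟪∂ᵢω, A ∂ᵢω⟫)`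

(`∂ᵢ` along the standard basis of `ℝ³`, `∂ₜ` the one-sided time derivative within `[0, T)`).
This is the Galanti–Gibbon–Heritage / Ohkitani "stretching Riccati law"
`D_t α = … − ∂²_ξ p + ν(…)` written for `r = ‖ω‖² α` (Galanti–Gibbon–Heritage, Nonlinearity 10
(1997) 1675; Majda–Bertozzi 2002, §1.4, the velocity-gradient equation (1.29)
`DV/Dt + V² = −P + νΔV`; Ohkitani 1993, `D_t(Sω) = −Pω` for Euler).

Proof (pure calculus, every ingredient a theorem of the tree or of Mathlib):
* Leibniz rules for the three derivatives of `r = ⟪ω, A ω⟫`: `∂ₜ` (`HasDerivWithinAt.inner`,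
  `HasDerivWithinAt.clm_apply`), `D(·)(u)` (`fderiv_inner_apply`, `fderiv_clm_apply`) and `Δ`
  (`laplacian_inner_eq` and the Leibniz rule `laplacian_clm_apply_eq` for `Δ (A w)` proved here);
* the vorticity equation `∂ₜω + Dω·u = A ω + νΔω`
  (`IsClassicalNSSolutionOn.isVorticitySolutionOn_of_uniqueDiffOn`, Majda–Bertozzi (2.110));
* the space derivative of the momentum equation, `D(∂ₜu) h + (D_h A) u + A (A h) = ν Δ(A) h − D(∇p) h`
  (`fderiv_timeDerivWithin_velocity_apply`; Majda–Bertozzi (1.29)), where `D ∂ₜ = ∂ₜ D`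
  (`IsSmoothSpaceTimeOn.timeDerivWithin_fderiv_slice_apply_of_uniqueDiffOn`) and `D Δ = Δ D`
  (`fderiv_laplacian_apply_of_contDiff_three`);
* the symmetry `(D_ω A) u = (D_u A) ω` of second derivatives (`ContDiffAt.isSymmSndFDerivAt`) and
  `⟪ω, D(∇p) ω⟫ = D²p[ω, ω]` (`inner_fderiv_gradient_eq_iteratedFDeriv`);
* the remaining cancellation of the transport terms is the linear identity `stretching_algebra`.

References: B. Galanti, J. D. Gibbon, M. Heritage, Nonlinearity 10 (1997) 1675–1694;
A. J. Majda, A. L. Bertozzi, *Vorticity and Incompressible Flow* (CUP 2002), §1.4 eq. (1.29),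
§2.4 eq. (2.110); K. Ohkitani, Phys. Fluids A 5 (1993) 2570.
-/

noncomputable section

open Set Function Filter Topology
open scoped InnerProductSpace RealInnerProductSpace Laplacian

-- the summit and its single sub-problem share the name (CONVENTIONS §1), as in every Theorems file
set_option linter.dupNamespace false

namespace Summit.NavierStokesRegularity.NavierStokesRegularity.Theorems.BlobRiccatiClosure.Sketch

open Literature.Analysis Literature.Analysis.FluidPDE
open Summit.NavierStokesRegularity.NavierStokesRegularity.Theorems

local notation "E³" => EuclideanSpace ℝ (Fin 3)

/-! ### The linear algebra of the cancellation -/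

/-- **The cancellation behind the stretching law**, as a linear identity in a real inner product
space: with `T = ⟪ω, Aₜω + A ωₜ⟫ + ⟪ωₜ, Aω⟫` (time derivative of `⟪ω, Aω⟫`),
`X = ⟪ω, A (Dω v) + (D_v A) ω⟫ + ⟪Dω v, Aω⟫` (space derivative along `v = u`),
`L = ⟪Δω, Aω⟫ + ⟪ω, (ΔA) ω + A Δω + 2 Σᵢ ∂ᵢA ∂ᵢω⟫ + 2 Σᵢ ⟪∂ᵢω, A ∂ᵢω + ∂ᵢA ω⟫` (Laplacian),
the vorticity equation `ωₜ + Dω v = Aω + νΔω`, the differentiated momentum equation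
`Aₜ ω + (D_ω A) v + A (A ω) = ν (ΔA) ω − P ω`, the symmetry `(D_ω A) v = (D_v A) ω` and
`⟪ω, P ω⟫ = H` give `T + X − ν L = ‖Aω‖² − H − 2ν Σᵢ (⟪ω, ∂ᵢA ∂ᵢω⟫ + ⟪∂ᵢω, ∂ᵢA ω⟫ + ⟪∂ᵢω, A ∂ᵢω⟫)`.
[folklore] -/
theorem stretching_algebra {V : Type*} [NormedAddCommGroup V] [InnerProductSpace ℝ V]
    {ι : Type*} [Fintype ι] (A : V →L[ℝ] V) (dA : ι → V →L[ℝ] V)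
    (ω ωt Dωv Lω Atω LAω Pω DAωv DAvω : V) (dω : ι → V) (ν H : ℝ)
    (hV : ωt + Dωv = A ω + ν • Lω)
    (hM : Atω + DAωv + A (A ω) = ν • LAω - Pω)
    (hS : DAωv = DAvω) (hH : ⟪ω, Pω⟫ = H) :
    (⟪ω, Atω + A ωt⟫ + ⟪ωt, A ω⟫) + (⟪ω, A Dωv + DAvω⟫ + ⟪Dωv, A ω⟫) -
      ν * (⟪Lω, A ω⟫ + ⟪ω, LAω + A Lω + (2:ℝ) • ∑ i, dA i (dω i)⟫ +
        2 * ∑ i, ⟪dω i, A (dω i) + dA i ω⟫) =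
    ‖A ω‖ ^ 2 - H - 2 * ν * ∑ i, (⟪ω, dA i (dω i)⟫ + ⟪dω i, dA i ω⟫ + ⟪dω i, A (dω i)⟫) := by
  obtain rfl : ωt = A ω + ν • Lω - Dωv := eq_sub_of_add_eq hV
  obtain rfl : Atω = ν • LAω - Pω - DAωv - A (A ω) := by
    rw [← hM]; abel
  subst hS
  rw [← hH, ← real_inner_self_eq_norm_sq]
  simp only [map_add, map_sub, map_smul, inner_add_right, inner_add_left, inner_sub_right,
    inner_sub_left, inner_smul_right, inner_smul_left, inner_sum, Finset.sum_add_distrib,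
    RCLike.conj_to_real]
  ring

/-! ### Leibniz rule for the Laplacian of `A w`, and `D Δ = Δ D` in operator form -/

section Calculus

variable {E : Type*} [NormedAddCommGroup E] [InnerProductSpace ℝ E] [FiniteDimensional ℝ E]
variable {F : Type*} [NormedAddCommGroup F] [NormedSpace ℝ F]
variable {G : Type*} [NormedAddCommGroup G] [NormedSpace ℝ G]

/-- **Leibniz rule for the Laplacian of an operator field applied to a vector field**: for `C²`
maps `A : E → (F →L G)` and `w : E → F` and an orthonormal basis `b` of `E`,
`Δ (A w) = (ΔA) w + A (Δw) + 2 Σᵢ (∂ᵢA) (∂ᵢw)` (expand the three Laplacians as `Σᵢ ∂ᵢ∂ᵢ`,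
`laplacian_eq_sum_fderiv_fderiv_normed`, and use `fderiv_clm_apply` twice). [folklore] -/
theorem laplacian_clm_apply_eq {ι : Type*} [Fintype ι] (b : OrthonormalBasis ι ℝ E)
    {A : E → F →L[ℝ] G} {w : E → F} (hA : ContDiff ℝ 2 A) (hw : ContDiff ℝ 2 w) (x : E) :
    (Δ fun y => A y (w y)) x =
      (Δ A) x (w x) + A x ((Δ w) x) +
        (2 : ℝ) • ∑ i, (fderiv ℝ A x (b i)) (fderiv ℝ w x (b i)) := by
  have hA1 : ContDiff ℝ 1 A := hA.of_le one_le_two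
  have hw1 : ContDiff ℝ 1 w := hw.of_le one_le_two
  have hAd : ∀ y, DifferentiableAt ℝ A y := fun y => hA1.differentiable one_ne_zero y
  have hwd : ∀ y, DifferentiableAt ℝ w y := fun y => hw1.differentiable one_ne_zero y
  have hAa : ∀ c, ContDiff ℝ 1 fun y => fderiv ℝ A y c := fun c =>
    (hA.fderiv_right (m := 1) le_rfl).clm_apply contDiff_const
  have hwa : ∀ c, ContDiff ℝ 1 fun y => fderiv ℝ w y c := fun c =>
    (hw.fderiv_right (m := 1) le_rfl).clm_apply contDiff_const
  rw [laplacian_eq_sum_fderiv_fderiv_normed b (hA.clm_apply hw) x,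
    laplacian_eq_sum_fderiv_fderiv_normed b hA x, laplacian_eq_sum_fderiv_fderiv_normed b hw x,
    _root_.sum_apply, map_sum, Finset.smul_sum, ← Finset.sum_add_distrib, ← Finset.sum_add_distrib]
  refine Finset.sum_congr rfl fun i _ => ?_
  have h1 : (fun y => fderiv ℝ (fun y => A y (w y)) y (b i)) =
      fun y => A y (fderiv ℝ w y (b i)) + (fderiv ℝ A y (b i)) (w y) := by
    funext y
    rw [fderiv_clm_apply (hAd y) (hwd y)]
    simp
  rw [h1]
  have hB1 : DifferentiableAt ℝ (fun y => fderiv ℝ w y (b i)) x :=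
    (hwa (b i)).differentiable one_ne_zero x
  have hB2 : DifferentiableAt ℝ (fun y => fderiv ℝ A y (b i)) x :=
    (hAa (b i)).differentiable one_ne_zero x
  have hP : DifferentiableAt ℝ (fun y => A y (fderiv ℝ w y (b i))) x := (hAd x).clm_apply hB1
  have hQ : DifferentiableAt ℝ (fun y => (fderiv ℝ A y (b i)) (w y)) x := hB2.clm_apply (hwd x)
  rw [fderiv_fun_add hP hQ, _root_.add_apply, fderiv_clm_apply (hAd x) hB1,
    fderiv_clm_apply hB2 (hwd x)]
  simp only [_root_.add_apply, ContinuousLinearMap.coe_comp, Function.comp_apply,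
    ContinuousLinearMap.flip_apply, two_smul]
  abel

/-- **`D(Δv)(x) = (Δ Dv)(x)`** as continuous linear maps, for a `C³` field on `ℝ³` (Schwarz twice:
`fderiv_laplacian_apply_of_contDiff_three`, and `Δ` commutes with evaluation). [folklore] -/
theorem fderiv_laplacian_eq_laplacian_fderiv {F' : Type*} [NormedAddCommGroup F']
    [InnerProductSpace ℝ F'] {v : E³ → F'} (hv : ContDiff ℝ 3 v) (x : E³) :
    fderiv ℝ (Δ v) x = (Δ (fderiv ℝ v)) x := by
  ext a
  have h2 : ContDiffAt ℝ 2 (fderiv ℝ v) x :=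
    (hv.fderiv_right (m := 2) (by norm_cast)).contDiffAt
  have h := h2.laplacian_CLM_comp_left (l := ContinuousLinearMap.apply ℝ F' a)
  have h' : (Δ (fun z => fderiv ℝ v z a)) x = (Δ (fderiv ℝ v)) x a := by
    simpa [Function.comp_def] using h
  rw [← h', fderiv_laplacian_apply_of_contDiff_three hv x a]

end Calculus

/-! ### The space derivative of the momentum equation -/

section Momentum

variable {S : Set ℝ} {ν : ℝ} {u : ℝ → E³ → E³} {p : ℝ → E³ → ℝ}

/-- **`∂ₜ D = D ∂ₜ` in operator form**: for a jointly smooth velocity on `S × ℝ³` (`S` of unique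
differentiability) and `t ∈ S`, the time derivative within `S` of the Jacobian field
`(s, y) ↦ D(u s)(y)` at `(t, x)` is the Jacobian of `∂ₜu(t, ·)` at `x`
(`IsSmoothSpaceTimeOn.timeDerivWithin_fderiv_slice_apply_of_uniqueDiffOn`, evaluated). [folklore] -/
theorem timeDerivWithin_fderiv_slice_eq_fderiv_timeDerivWithin (hu : IsSmoothSpaceTimeOn S u)
    (hS : UniqueDiffOn ℝ S) {t : ℝ} (ht : t ∈ S) (x : E³) :
    timeDerivWithin S (fun s y => fderiv ℝ (u s) y) t x = fderiv ℝ (timeDerivWithin S u t) x := by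
  ext a
  rw [← hu.timeDerivWithin_fderiv_slice_apply_of_uniqueDiffOn hS ht x a, timeDerivWithin_apply,
    timeDerivWithin_apply,
    derivWithin_clm_apply ((hu.fderiv_slice hS).differentiableWithinAt_time ht x)
      (differentiableWithinAt_const _)]
  simp

/-- **The velocity-gradient equation** (space derivative of the momentum equation,
Majda–Bertozzi (1.29) `DV/Dt + V² = −P + νΔV`): for a classical solution of unforced
Navier–Stokes on a time set `S`, `t ∈ S` and `x, a ∈ ℝ³`,
`D(∂ₜu)(x) a + (D_a A)(u) + A (A a) = ν (Δ A) a − D(∇p)(x) a` with `A = D(u t)`; here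
`D Δu = Δ Du` by `fderiv_laplacian_eq_laplacian_fderiv`.
[cite: MajdaBertozziCUP2002, §1.4 eq. (1.29)] -/
theorem fderiv_timeDerivWithin_velocity_apply (h : IsClassicalNSSolutionOn S ν 0 u p)
    {t : ℝ} (ht : t ∈ S) (x a : E³) :
    fderiv ℝ (timeDerivWithin S u t) x a + fderiv ℝ (fderiv ℝ (u t)) x a (u t x) +
        fderiv ℝ (u t) x (fderiv ℝ (u t) x a) =
      ν • (Δ (fderiv ℝ (u t))) x a - fderiv ℝ (gradient (p t)) x a := by
  have hu3 : ContDiff ℝ 3 (u t) := contDiff_infty.1 (h.contDiff_velocity ht) 3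
  have hu2 : ContDiff ℝ 2 (u t) := hu3.of_le (by norm_num)
  have hp2 : ContDiff ℝ 2 (p t) := contDiff_infty.1 (h.contDiff_pressure ht) 2
  have hud : Differentiable ℝ (u t) := hu2.differentiable two_ne_zero
  have hDud : Differentiable ℝ (fderiv ℝ (u t)) :=
    (hu2.fderiv_right (m := 1) le_rfl).differentiable one_ne_zero
  have hΔd : Differentiable ℝ (Δ (u t)) := differentiable_laplacian hu3
  have hgd : Differentiable ℝ (gradient (p t)) := by
    have hg : gradient (p t) = (InnerProductSpace.toDual ℝ E³).symm ∘ fderiv ℝ (p t) := rfl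
    rw [hg]
    exact ((InnerProductSpace.toDual ℝ E³).symm.contDiff.comp
      (hp2.fderiv_right (m := 1) le_rfl)).differentiable one_ne_zero
  have hcd : Differentiable ℝ (fun y => fderiv ℝ (u t) y (u t y)) := hDud.clm_apply hud
  -- the momentum equation solved for `∂ₜu`
  have hmom : timeDerivWithin S u t =
      fun y => ν • (Δ (u t)) y - gradient (p t) y - fderiv ℝ (u t) y (u t y) := by
    funext y
    have hm := h.momentum t ht y
    simp only [convect_apply, Pi.zero_apply, add_zero] at hm
    rw [← hm]
    abel
  have d1 : DifferentiableAt ℝ (fun y => ν • (Δ (u t)) y) x := (hΔd x).const_smul ν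
  have d2 : DifferentiableAt ℝ (fun y => ν • (Δ (u t)) y - gradient (p t) y) x := d1.sub (hgd x)
  rw [hmom, fderiv_fun_sub d2 (hcd x), fderiv_fun_sub d1 (hgd x), fderiv_fun_const_smul (hΔd x),
    fderiv_clm_apply (hDud x) (hud x), fderiv_laplacian_eq_laplacian_fderiv hu3 x]
  simp only [_root_.sub_apply, _root_.smul_apply, _root_.add_apply,
    ContinuousLinearMap.coe_comp, Function.comp_apply, ContinuousLinearMap.flip_apply]
  abel

end Momentum

/-! ### The stub -/

/-- **S5, STRETCHING EVOLUTION IDENTITY.** For a classical solution of unforced Navier–Stokes on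
`[0, T)`, with `ω = curl u`, `A = ∇u` (`A h = Du·h`, so `(ω·∇)u = A ω`), the vortex-stretching density
`r = ⟪ω, A ω⟫ = ‖ω‖² α` obeys pointwise on `[0, T) × ℝ³`
`(∂ₜ + u·∇ − νΔ) r = ‖A ω‖² − D²p[ω, ω] − 2ν Σᵢ (⟪ω, ∂ᵢA ∂ᵢω⟫ + ⟪∂ᵢω, ∂ᵢA ω⟫ + ⟪∂ᵢω, A ∂ᵢω⟫)`
(`∂ᵢ` along the standard basis). Ingredients: the vorticity equation `(∂ₜ + u·∇ − νΔ)ω = Aω`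
(`IsClassicalNSSolutionOn.isVorticitySolutionOn_of_uniqueDiffOn`), the spatial derivative of the
momentum equation `(∂ₜ + u·∇ − νΔ)A = −A∘A − D∇p` (Ohkitani: `D_t(Sω) = −Pω` for Euler), and the
Leibniz rule for `Δ`. Galanti–Gibbon–Heritage, Nonlinearity 10 (1997) 1675, eq. for `α`;
Majda–Bertozzi §1.4. Registered as a tool for the bet; not used by the composition.
[cite: MajdaBertozziCUP2002, §1.4 eq. (1.29) and §2.4 eq. (2.110)] -/
theorem stub_stretchingEvolution :
    ∀ (ν T : ℝ) (u : ℝ → E³ → E³) (p : ℝ → E³ → ℝ), 0 < T →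
      IsClassicalNSSolutionOn (Ico 0 T) ν 0 u p →
      ∀ t ∈ Ico 0 T, ∀ x : E³,
        timeDerivWithin (Ico 0 T) (fun s y => ⟪curl (u s) y, fderiv ℝ (u s) y (curl (u s) y)⟫) t x +
            fderiv ℝ (fun y => ⟪curl (u t) y, fderiv ℝ (u t) y (curl (u t) y)⟫) x (u t x) -
            ν * Laplacian.laplacian
              (fun y => ⟪curl (u t) y, fderiv ℝ (u t) y (curl (u t) y)⟫) x =
          ‖fderiv ℝ (u t) x (curl (u t) x)‖ ^ 2 -
            iteratedFDeriv ℝ 2 (p t) x ![curl (u t) x, curl (u t) x] -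
            2 * ν * ∑ i : Fin 3,
              (⟪curl (u t) x, (fderiv ℝ (fderiv ℝ (u t)) x (EuclideanSpace.single i 1))
                  (fderiv ℝ (curl (u t)) x (EuclideanSpace.single i 1))⟫ +
                ⟪fderiv ℝ (curl (u t)) x (EuclideanSpace.single i 1),
                  (fderiv ℝ (fderiv ℝ (u t)) x (EuclideanSpace.single i 1)) (curl (u t) x)⟫ +
                ⟪fderiv ℝ (curl (u t)) x (EuclideanSpace.single i 1),
                  fderiv ℝ (u t) x (fderiv ℝ (curl (u t)) x (EuclideanSpace.single i 1))⟫) := by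
  intro ν T u p _hT hsol t ht x
  have hS : UniqueDiffOn ℝ (Ico 0 T) := uniqueDiffOn_Ico 0 T
  set b : OrthonormalBasis (Fin 3) ℝ E³ := EuclideanSpace.basisFun (Fin 3) ℝ with hb
  -- regularity of the slices
  have hu3 : ContDiff ℝ 3 (u t) := contDiff_infty.1 (hsol.contDiff_velocity ht) 3
  have hu2 : ContDiff ℝ 2 (u t) := hu3.of_le (by norm_num)
  have hA2 : ContDiff ℝ 2 (fderiv ℝ (u t)) := hu3.fderiv_right (m := 2) le_rfl
  have hω2 : ContDiff ℝ 2 (curl (u t)) := contDiff_two_vorticity_of_classical hsol ht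
  have hωd : ∀ y, DifferentiableAt ℝ (curl (u t)) y := fun y => hω2.differentiable two_ne_zero y
  have hAd : ∀ y, DifferentiableAt ℝ (fderiv ℝ (u t)) y := fun y =>
    hA2.differentiable two_ne_zero y
  have hG2 : ContDiff ℝ 2 (fun y => fderiv ℝ (u t) y (curl (u t) y)) := hA2.clm_apply hω2
  -- joint smoothness of `ω` and `A`
  have hωs : IsSmoothSpaceTimeOn (Ico 0 T) (vorticity u) :=
    isSmoothSpaceTimeOn_vorticity_of_classical hsol hS
  have hAs : IsSmoothSpaceTimeOn (Ico 0 T) (fun s y => fderiv ℝ (u s) y) :=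
    hsol.smooth_velocity.fderiv_slice hS
  have hωt := hωs.hasDerivWithinAt_timeDerivWithin hS ht x
  have hAt := hAs.hasDerivWithinAt_timeDerivWithin hS ht x
  -- (T) the time derivative of `r`
  have hT : timeDerivWithin (Ico 0 T)
      (fun s y => ⟪curl (u s) y, fderiv ℝ (u s) y (curl (u s) y)⟫) t x =
      ⟪curl (u t) x, timeDerivWithin (Ico 0 T) (fun s y => fderiv ℝ (u s) y) t x (curl (u t) x) +
          fderiv ℝ (u t) x (timeDerivWithin (Ico 0 T) (vorticity u) t x)⟫ +
        ⟪timeDerivWithin (Ico 0 T) (vorticity u) t x, fderiv ℝ (u t) x (curl (u t) x)⟫ := by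
    rw [timeDerivWithin_apply]
    exact (hωt.inner ℝ (hAt.clm_apply hωt)).derivWithin (hS t ht)
  -- (X) the space derivative of `r` along `u`
  have hX : fderiv ℝ (fun y => ⟪curl (u t) y, fderiv ℝ (u t) y (curl (u t) y)⟫) x (u t x) =
      ⟪curl (u t) x, fderiv ℝ (u t) x (fderiv ℝ (curl (u t)) x (u t x)) +
          fderiv ℝ (fderiv ℝ (u t)) x (u t x) (curl (u t) x)⟫ +
        ⟪fderiv ℝ (curl (u t)) x (u t x), fderiv ℝ (u t) x (curl (u t) x)⟫ := by
    rw [fderiv_inner_apply ℝ (hωd x) (hG2.differentiable two_ne_zero x),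
      fderiv_clm_apply (hAd x) (hωd x)]
    simp only [_root_.add_apply, ContinuousLinearMap.coe_comp, Function.comp_apply,
      ContinuousLinearMap.flip_apply]
  -- (L) the Laplacian of `r`
  have hL : (Δ fun y => ⟪curl (u t) y, fderiv ℝ (u t) y (curl (u t) y)⟫) x =
      ⟪(Δ (curl (u t))) x, fderiv ℝ (u t) x (curl (u t) x)⟫ +
        ⟪curl (u t) x, (Δ (fderiv ℝ (u t))) x (curl (u t) x) +
          fderiv ℝ (u t) x ((Δ (curl (u t))) x) +
          (2 : ℝ) • ∑ i, fderiv ℝ (fderiv ℝ (u t)) x (b i) (fderiv ℝ (curl (u t)) x (b i))⟫ +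
        2 * ∑ i, ⟪fderiv ℝ (curl (u t)) x (b i),
          fderiv ℝ (u t) x (fderiv ℝ (curl (u t)) x (b i)) +
            fderiv ℝ (fderiv ℝ (u t)) x (b i) (curl (u t) x)⟫ := by
    rw [laplacian_inner_eq b hω2 hG2 x, laplacian_clm_apply_eq b hA2 hω2 x,
      fderiv_clm_apply (hAd x) (hωd x)]
    simp only [_root_.add_apply, ContinuousLinearMap.coe_comp, Function.comp_apply,
      ContinuousLinearMap.flip_apply]
  -- (V) the vorticity equation at `(t, x)`
  have hV := (hsol.isVorticitySolutionOn_of_uniqueDiffOn hS (fun _ _ _ => by simp [curl])).vorticity_eq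
    t ht x
  simp only [vorticity_apply, convect_apply] at hV
  -- (M) the differentiated momentum equation at `(t, x)`, applied to `ω`
  have hM : timeDerivWithin (Ico 0 T) (fun s y => fderiv ℝ (u s) y) t x (curl (u t) x) +
        fderiv ℝ (fderiv ℝ (u t)) x (curl (u t) x) (u t x) +
        fderiv ℝ (u t) x (fderiv ℝ (u t) x (curl (u t) x)) =
      ν • (Δ (fderiv ℝ (u t))) x (curl (u t) x) - fderiv ℝ (gradient (p t)) x (curl (u t) x) := by
    rw [timeDerivWithin_fderiv_slice_eq_fderiv_timeDerivWithin hsol.smooth_velocity hS ht x]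
    exact fderiv_timeDerivWithin_velocity_apply hsol ht x _
  -- (S) symmetry of `D²u` and (H) the pressure Hessian
  have h22 : minSmoothness ℝ 2 ≤ (2 : WithTop ℕ∞) := by
    rw [minSmoothness_of_isRCLikeNormedField]
  have hSy : fderiv ℝ (fderiv ℝ (u t)) x (curl (u t) x) (u t x) =
      fderiv ℝ (fderiv ℝ (u t)) x (u t x) (curl (u t) x) :=
    (hu2.contDiffAt.isSymmSndFDerivAt h22).eq _ _
  have hH : ⟪curl (u t) x, fderiv ℝ (gradient (p t)) x (curl (u t) x)⟫ =
      iteratedFDeriv ℝ 2 (p t) x ![curl (u t) x, curl (u t) x] :=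
    inner_fderiv_gradient_eq_iteratedFDeriv (p t) x _ _
  -- assemble
  rw [hT, hX, hL]
  simp only [hb, EuclideanSpace.basisFun_apply]
  exact stretching_algebra _ _ _ _ _ _ _ _ _ _ _ _ ν _ hV hM hSy hH

end Summit.NavierStokesRegularity.NavierStokesRegularity.Theorems.BlobRiccatiClosure.Sketch

end
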